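import Summits.ResolutionOfSingularities.ResolutionOfSingularities.Theorems.PurelyInseparableDim4ResConeCInfTranslatedStepPrime
import HarnessLib
import HarnessLib.Audit.Tags

/-!
# Purely inseparable four-folds — LEVEL-`k` PINNING WITH THE WITNESS ROW AS A PARAMETER, every prime: in regime R_k (slot exponents
# `≥ k + 1` in row `c`) the level-`k` flag `x_j^{k+1}x_i^{k+1}x_u^{d−k−c}x_f^c` (pivot `d − k − c`) pins the u-translation of a slot step once its
# cross element is dead and the child's `x_j^{k+1}x_i^{k+1}x_u^{d−k−1−c}x_f^c` is absent (cell `res-dim4-pi`, K2(p) lane, power-cone light-pair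
# line, flagless branch, FILE ♯5-level: (VT-u) of res-dim4-typ-1 is `k = 1`, (VT-u♯) of ♯1 §5 / ♯5 is `k = 2, c = 0`)

[OURS · counted 0 · cell `res-dim4-pi` · K2(p) lane (holder res-dim4-p-12 g5, ruling g5-26: «type (VT-u♯) with the witness-position set U and its
pivot as PARAMETERS; d = 6 is an instance»); seat res-dim4-p-3 g6 (MEMO `res-dim4-p-3/MEMO-g6-FLAGLESS-SHARP.md` §3, §7, §7′ «level hierarchy»).]
Nothing here proves K2(p) for any `p`, any TAIL(p, p−1, 3), `NoIsolatedTrap p p`, the Cossart–Jannsen–Saito theorem or resolution of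
singularities in dimension ≥ 4 / characteristic `p` — NOT proved.  AI kernel work, weaker than expert review.  Exponent algebra of OUR frame.

F-exponents `(e_j, e_i, e_u, e_f)` (= residual exponents + `(1,1,0,0)`); `d + 1 = p`.  LEVEL `k ≥ 1`, ROW `c`, with `k + c + 1 ≤ d`:
the level-`k` flag is `Φ = (k+1, k+1, d−k−c, c)` (residual `κ^k o^k u^{d−k−c} f^c`, degree `d + k` as a residual monomial), its CROSS element
`(k+2, k+1, d−k−1−c, c)`, the child monomial it pins through `(k+1, k+1, d−k−1−c, c)`, the pivot binomial `C(d−k−c, d−k−1−c) = d − k − c`.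
REGIME R_k in row `c`: every monomial with `e_f = c` has `e_j ≥ k + 1`.
* **`coeff_level_step_translate_u (k c)`** — `coeff (k+1,k+1,d−k−1−c,c) (child at β) = (d−k−c)·β·coeff Φ (parent) + coeff (cross) (parent)`: the
  line `{|δ| = d + k + 2, δ_i = k+1, δ_f = c}` has, in regime R_k, only the two members `δ_u ∈ {d−k−c, d−k−1−c}`.
* **`translation_eq_zero_of_level (k c)`** — hence `β = 0` when the child monomial and the cross vanish and `coeff Φ ≠ 0` (`(d−k−c : K) ≠ 0` since
  `0 < d−k−c < p`).  `k = 1`: res-dim4-typ-1's (VT-u) row `c′ = c` (flag `x_j²x_i²x_u^{d−1−c}x_f^c`, dead ROW element `x_j³x_i²x_u^{d−2−c}x_f^c`);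
  `k = 2, c = 0`: ♯5 `translation_eq_zero_of_sharp`.  Which `(k, c)` carries a non-zero flag on a given chain is MEMO §7/§7′ (the level
  hierarchy: least `k` with a non-zero level-`k` flag vector; isolation bounds it by `2k + c ≤ d − 2`), OPEN AND NAMED beyond `d = 6`.
[cite: Hauser2010, §§F–G] [cite: CossartJannsenSaito2020, Thm. 3.14]
bears_on: LADDER-RESOLUTION:D157-DOOR2 (res-dim4-pi · K2(p) · power cones · flagless branch ♯5-level).  Supports
stmt-ResolutionOfSingularities-16155 (helper).
-/

set_option linter.dupNamespace false -- mandated namespace of this single-conjunct summit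

noncomputable section

namespace Summit.ResolutionOfSingularities.ResolutionOfSingularities.Theorems.PIDim4

namespace ResCone

open MvPolynomial Finset
open Literature.AlgebraicGeometry.Resolution
open Literature.AlgebraicGeometry.Resolution.CentreBlowup
open Literature.AlgebraicGeometry.Resolution.Hauser2010
open Literature.AlgebraicGeometry.Resolution.HauserPerlega2019

variable {K : Type} [Field K] [DecidableEq K]

section Step

variable {j i u f : Fin 4} (hji : j ≠ i) (hju : j ≠ u) (hjf : j ≠ f) (hiu : i ≠ u) (hif : i ≠ f) (huf : u ≠ f)
include hji hju hjf hiu hif huf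

/-- **LEVEL-`k`, ROW-`c` PINNING IDENTITY** (`d + 1 = p`, `1 ≤ k`, `k + c + 1 ≤ d`): if every parent monomial with contact exponent `c` has
`e_j ≥ k + 1`, then at the slot step in the chart of `j` translated by `β·e_u`
`coeff (x_j^{k+1}x_i^{k+1}x_u^{d−k−1−c}x_f^c) F′ = (d − k − c)·β·coeff (x_j^{k+1}x_i^{k+1}x_u^{d−k−c}x_f^c) F + coeff (x_j^{k+2}x_i^{k+1}x_u^{d−k−1−c}x_f^c) F`.
[OURS] [cite: Hauser2010, §§F–G] -/
theorem coeff_level_step_translate_u (p : ℕ) {d : ℕ} (hdp : d + 1 = p) (k c : ℕ) (hk : 1 ≤ k) (hkc : k + c + 1 ≤ d) (s : State K)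
    (hq : ((p : ℕ) : ℕ∞) ≤ ordAlong Finset.univ s.F) (hR : ∀ e ∈ s.F.support, e f = c → k + 1 ≤ e j) (β : K) :
    coeff (Finsupp.single j (k + 1) + Finsupp.single i (k + 1) + Finsupp.single u (d - k - 1 - c) + Finsupp.single f c)
        (CentreBlowup.step p Finset.univ j (Function.update (0 : Fin 4 → K) u β) s).F =
      ((d - k - c : ℕ) : K) * β *
          coeff (Finsupp.single j (k + 1) + Finsupp.single i (k + 1) + Finsupp.single u (d - k - c) + Finsupp.single f c) s.F +
        coeff (Finsupp.single j (k + 2) + Finsupp.single i (k + 1) + Finsupp.single u (d - k - 1 - c) + Finsupp.single f c) s.F := by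
  classical
  set γ : Fin 4 →₀ ℕ := Finsupp.single i (k + 1) + Finsupp.single u (d - k - 1 - c) + Finsupp.single f c with hγdef
  have hγj : γ j = 0 := by
    rw [hγdef, Finsupp.add_apply, Finsupp.add_apply, Finsupp.single_eq_of_ne hji, Finsupp.single_eq_of_ne hju,
      Finsupp.single_eq_of_ne hjf]; simp
  have hγi : γ i = k + 1 := by
    rw [hγdef, Finsupp.add_apply, Finsupp.add_apply, Finsupp.single_eq_same, Finsupp.single_eq_of_ne hiu,
      Finsupp.single_eq_of_ne hif]; simp
  have hγu : γ u = d - k - 1 - c := by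
    rw [hγdef, Finsupp.add_apply, Finsupp.add_apply, Finsupp.single_eq_of_ne hiu.symm, Finsupp.single_eq_same,
      Finsupp.single_eq_of_ne huf]; simp
  have hγf : γ f = c := by
    rw [hγdef, Finsupp.add_apply, Finsupp.add_apply, Finsupp.single_eq_of_ne hif.symm, Finsupp.single_eq_of_ne huf.symm,
      Finsupp.single_eq_same]; simp
  have hE : (Finsupp.single j (k + 1) + Finsupp.single i (k + 1) + Finsupp.single u (d - k - 1 - c) + Finsupp.single f c : Fin 4 →₀ ℕ) =
      γ + Finsupp.single j (p + (k + 1) - p) := by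
    rw [hγdef, Nat.add_sub_cancel_left]
    simp only [add_comm, add_left_comm]
  set E₁ : Fin 4 →₀ ℕ := Finsupp.single j (k + 1) + Finsupp.single i (k + 1) + Finsupp.single u (d - k - c) + Finsupp.single f c
    with hE₁
  set E₂ : Fin 4 →₀ ℕ := Finsupp.single j (k + 2) + Finsupp.single i (k + 1) + Finsupp.single u (d - k - 1 - c) + Finsupp.single f c
    with hE₂
  obtain ⟨h1j, h1i, h1u, h1f⟩ := quad_apply hji hju hjf hiu hif huf (k + 1) (k + 1) (d - k - c) c
  obtain ⟨h2j, h2i, h2u, h2f⟩ := quad_apply hji hju hjf hiu hif huf (k + 2) (k + 1) (d - k - 1 - c) c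
  have hnp : ¬ IsPthPowerExponent p (γ + Finsupp.single j (p + (k + 1) - p)) := by
    rw [← hE, isPthPowerExponent_iff]
    intro h
    have h3 := h i
    rw [(quad_apply hji hju hjf hiu hif huf (k + 1) (k + 1) (d - k - 1 - c) c).2.1] at h3
    have := Nat.le_of_dvd (by omega) h3
    omega
  rw [hE, coeff_step_translate_u hji hju hjf hiu hif huf p s hq β (Nat.le_add_right p (k + 1)) γ hγj hnp]
  have hne : E₁ ≠ E₂ := fun h => by
    have hj' : E₁ j = E₂ j := by rw [h]
    rw [h1j, h2j] at hj'
    omega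
  rw [Finset.sum_eq_add E₁ E₂ hne]
  · rw [h1u, h2u, hγu, show d - k - c - (d - k - 1 - c) = 1 by omega, show d - k - c = d - k - 1 - c + 1 by omega,
      Nat.choose_succ_self_right, show d - k - 1 - c + 1 = d - k - c by omega, Nat.choose_self, Nat.sub_self, pow_one, pow_zero,
      Nat.cast_one, one_mul, one_mul]
  · intro δ hδ hδne
    rw [Finset.mem_filter] at hδ
    obtain ⟨hmem, hdeg, hδi, hδf⟩ := hδ
    rw [hγi] at hδi
    rw [hγf] at hδf
    have hδj : k + 1 ≤ δ j := hR δ hmem hδf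
    have hdeg' := degree_eq_quad hji hju hjf hiu hif huf δ
    rw [hδi, hδf] at hdeg'
    rcases Nat.lt_or_ge (δ u) (γ u) with hlt | hge
    · rw [Nat.choose_eq_zero_of_lt hlt, Nat.cast_zero, zero_mul, zero_mul]
    · exfalso
      rw [hγu] at hge
      have hsplit : (δ j = k + 1 ∧ δ u = d - k - c) ∨ (δ j = k + 2 ∧ δ u = d - k - 1 - c) := by omega
      rcases hsplit with ⟨hj', hu'⟩ | ⟨hj', hu'⟩
      · apply hδne.1
        rw [eq_sum_single_four hji hju hjf hiu hif huf δ, hj', hδi, hu', hδf]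
      · apply hδne.2
        rw [eq_sum_single_four hji hju hjf hiu hif huf δ, hj', hδi, hu', hδf]
  · intro hnot
    by_cases h0 : coeff E₁ s.F = 0
    · rw [h0, mul_zero]
    · exfalso
      exact hnot (Finset.mem_filter.mpr
        ⟨mem_support_iff.mpr h0, by rw [hE₁, degree_quad]; omega, by rw [h1i, hγi], by rw [h1f, hγf]⟩)
  · intro hnot
    by_cases h0 : coeff E₂ s.F = 0
    · rw [h0, mul_zero]
    · exfalso
      exact hnot (Finset.mem_filter.mpr
        ⟨mem_support_iff.mpr h0, by rw [hE₂, degree_quad]; omega, by rw [h2i, hγi], by rw [h2f, hγf]⟩)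

/-- **LEVEL-`k`, ROW-`c` PINNING** (`d + 1 = p = char K`, `1 ≤ k`, `k + c + 1 ≤ d`): regime R_k in row `c` (`e_f = c ⇒ e_j ≥ k + 1`), the
cross element dead, the level-`k` flag non-zero, and the pinned child monomial absent ⇒ the translation `β` of the slot step is `0`. [OURS]
[cite: Hauser2010, §§F–G] [cite: CossartJannsenSaito2020, Thm. 3.14] -/
theorem translation_eq_zero_of_level (p : ℕ) [CharP K p] {d : ℕ} (hdp : d + 1 = p) (k c : ℕ) (hk : 1 ≤ k) (hkc : k + c + 1 ≤ d)
    (s : State K) (hq : ((p : ℕ) : ℕ∞) ≤ ordAlong Finset.univ s.F) (hR : ∀ e ∈ s.F.support, e f = c → k + 1 ≤ e j) (β : K)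
    (hcross : coeff (Finsupp.single j (k + 2) + Finsupp.single i (k + 1) + Finsupp.single u (d - k - 1 - c) + Finsupp.single f c)
      s.F = 0)
    (hg : coeff (Finsupp.single j (k + 1) + Finsupp.single i (k + 1) + Finsupp.single u (d - k - c) + Finsupp.single f c) s.F ≠ 0)
    (hlayer : coeff (Finsupp.single j (k + 1) + Finsupp.single i (k + 1) + Finsupp.single u (d - k - 1 - c) + Finsupp.single f c)
      (CentreBlowup.step p Finset.univ j (Function.update (0 : Fin 4 → K) u β) s).F = 0) :
    β = 0 := by
  have h := coeff_level_step_translate_u hji hju hjf hiu hif huf p hdp k c hk hkc s hq hR β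
  rw [hlayer, hcross, add_zero] at h
  have hK : ((d - k - c : ℕ) : K) ≠ 0 := by
    intro h0
    rw [CharP.cast_eq_zero_iff K p] at h0
    have := Nat.le_of_dvd (by omega) h0
    omega
  rcases mul_eq_zero.mp h.symm with h1 | h2
  · rcases mul_eq_zero.mp h1 with h3 | h4
    · exact absurd h3 hK
    · exact h4
  · exact absurd h2 hg

end Step

end ResCone

end Summit.ResolutionOfSingularities.ResolutionOfSingularities.Theorems.PIDim4
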